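import Summits.CriticalPhenomena.PercolationContinuityZ3.Theorems.Transplant.SkelNegBParamsFaceLamA
import Summits.CriticalPhenomena.PercolationContinuityZ3.Theorems.Transplant.SkelNegBParamsResidualsA
import Summits.CriticalPhenomena.PercolationContinuityZ3.Theorems.Transplant.SkelPhiRootBridgeData
import HarnessLib

/-!
# N1 params, chain of record `NegB`, part BridgeFrameF — THE WIDE y′-FACE BRIDGE FRAMES ((L-F1) (ii); ruling (α) p3-g12 06:11:51Z: UNFATTENED, the landing box
# `B₀` is the long pair's top-edge segment as in the record's B.13 frames): **`KS.BFs/BFd/BFt c mk g f σ := Skelφ.bridgeSame/bridgeTrSide/bridgeTrTop σ n_L h_L ℓ_L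
# (RA′ mk) (nBF c mk) (hBF c mk) (ℓBF c mk)`** with `BF_eq` (rfl), **`BF_ok`** (`BridgeOK`, all three, from `Skelφ.bridgeOK_all`, `3 ≤ ℓBF`), **`BF_shared`** (the three share
# `B₀lo = pt n_L (σh_L)`, `B₀hi = pt n_L (σh_L + ℓ_L)`, `R′ = RA′`, `pr = prBF`), **`BF_R'_ge : RlevA + 1 ≤ R′`**, **`hB0_F`** (the hop box IS `B₀`), **`hclr₁_BF`** (`M_u < B₀lo 0 − R′ − pr`
# at `g := gT mk gx` under the face floor `16·S_F ≤ M_L`), the core-`1` reach **`KS.YbF c mk g f := 2·(n_L + |h_L| + ℓ_L + RA′ + S_F + 11)`** with **`core1LoF_l1`** (all three frames,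
# `27 ≤ ℓBF`) and **`YbF_le_exA`** (`YbF + 1 ≤ exA` under `|h_L| ≤ 10n_L`, `S_F ≤ n_L`, `RA′ ≤ n_L` — for hp-8's `hπ1` via `KS.ex_le_RπA`). The δ₂-count for G10 is
# `KS.counts_δ … .2.1` (SkelNegBParamsSlots, landed).  (stmt-g16 2026-08-22; slot-ledger ζ′ v1.)
builds on p205010 (kernel theorem, internal audit signed; external expert review pending) — nothing in this file uses p205010; NOTHING is claimed about the node
`SamePDropOfSkeletonNeg₁` (OPEN).
Lane `prim-bschramm-*`, seat `prim-bschramm-stmt` (gen 16); helper file (`--supports stmt-CriticalPhenomena-4575 --as helper`); ledger HOME/prim-bschramm-stmt/NEG-PARAMS.md v0.19.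
[cite: KozmaNitzan2024, §4 p. 28 ((32) at the root), Theorem 6 (pp. 25–31)] [cite: MartineauTassion2017, §4.3 Lemma 4.2]
-/

noncomputable section

open scoped Classical

namespace Summit.CriticalPhenomena.PercolationContinuityZ3.Theorems.Transplant

namespace PlanarSkeletonNeg

namespace NegB

open Literature.Probability.Percolation Literature.Probability.LatticeModels SimpleGraph
open SkelConc (Consts)
open Skelφ (sgnz sgnz_cases)
open Skelφ.StepI (DataN)
open ChainPlanar (BridgePrm BridgeOK)
open Neg

namespace KS

/-! ## §1 The three face frames and their shared fields -/

section Frames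

variable (κ : Consts) {V : Type} [DecidableEq V] [Countable V] {G : SimpleGraph V} [G.LocallyFinite] (Φ : PlanarSkeletonNeg G) (t : V)
  (p : unitInterval) (D : DataN V) (c mk : ℕ) (g f : ℕ)

/-- **The face bridge frame, case `o_b = o_L`** (at the wide pair `(nBF, hBF, ℓBF)`). [this work] -/
def BFs (σ : ℤ) : BridgePrm :=
  Skelφ.bridgeSame σ (nL κ Φ t p D g f) (hL κ Φ t p D g f) (ℓL κ Φ t p D g f) (RA' κ Φ t p D mk) (nBF κ Φ t p D c mk) (hBF κ Φ t p D c mk) (ℓBF κ Φ t p D c mk)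

/-- **The face bridge frame, case `o_b ≠ o_L`, steep.** [this work] -/
def BFd (σ : ℤ) : BridgePrm :=
  Skelφ.bridgeTrSide σ (nL κ Φ t p D g f) (hL κ Φ t p D g f) (ℓL κ Φ t p D g f) (RA' κ Φ t p D mk) (nBF κ Φ t p D c mk) (hBF κ Φ t p D c mk) (ℓBF κ Φ t p D c mk)

/-- **The face bridge frame, case `o_b ≠ o_L`, flat.** [this work] -/
def BFt (σ : ℤ) : BridgePrm :=
  Skelφ.bridgeTrTop σ (nL κ Φ t p D g f) (hL κ Φ t p D g f) (ℓL κ Φ t p D g f) (RA' κ Φ t p D mk) (nBF κ Φ t p D c mk) (hBF κ Φ t p D c mk) (ℓBF κ Φ t p D c mk)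

/-- The three frames unfold (by `rfl`). [folklore] -/
theorem BF_eq (σ : ℤ) :
    BFs κ Φ t p D c mk g f σ = Skelφ.bridgeSame σ (nL κ Φ t p D g f) (hL κ Φ t p D g f) (ℓL κ Φ t p D g f) (RA' κ Φ t p D mk) (nBF κ Φ t p D c mk) (hBF κ Φ t p D c mk) (ℓBF κ Φ t p D c mk) ∧
      BFd κ Φ t p D c mk g f σ = Skelφ.bridgeTrSide σ (nL κ Φ t p D g f) (hL κ Φ t p D g f) (ℓL κ Φ t p D g f) (RA' κ Φ t p D mk) (nBF κ Φ t p D c mk) (hBF κ Φ t p D c mk) (ℓBF κ Φ t p D c mk) ∧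
      BFt κ Φ t p D c mk g f σ = Skelφ.bridgeTrTop σ (nL κ Φ t p D g f) (hL κ Φ t p D g f) (ℓL κ Φ t p D g f) (RA' κ Φ t p D mk) (nBF κ Φ t p D c mk) (hBF κ Φ t p D c mk) (ℓBF κ Φ t p D c mk) :=
  ⟨rfl, rfl, rfl⟩

/-- **The three face frames are admissible** (`3 ≤ ℓBF`, `σ = ±1`). [folklore] -/
theorem BF_ok {σ : ℤ} (hσ : σ = 1 ∨ σ = -1) (hℓ : 3 ≤ ℓBF κ Φ t p D c mk) :
    BridgeOK (BFs κ Φ t p D c mk g f σ) ∧ BridgeOK (BFd κ Φ t p D c mk g f σ) ∧ BridgeOK (BFt κ Φ t p D c mk g f σ) :=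
  Skelφ.bridgeOK_all hσ _ _ _ _ _ _ hℓ

/-- **The shared fields**: all three frames have `B₀lo = pt n_L (σh_L)`, `B₀hi = pt n_L (σh_L + ℓ_L)`, `R′ = RA′`, `pr = prBF`. [folklore] -/
theorem BF_shared (σ : ℤ) :
    ((BFs κ Φ t p D c mk g f σ).B₀lo = Skelφ.pt (nL κ Φ t p D g f : ℤ) (σ * hL κ Φ t p D g f) ∧ (BFd κ Φ t p D c mk g f σ).B₀lo = Skelφ.pt (nL κ Φ t p D g f : ℤ) (σ * hL κ Φ t p D g f) ∧
        (BFt κ Φ t p D c mk g f σ).B₀lo = Skelφ.pt (nL κ Φ t p D g f : ℤ) (σ * hL κ Φ t p D g f)) ∧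
      ((BFs κ Φ t p D c mk g f σ).B₀hi = Skelφ.pt (nL κ Φ t p D g f : ℤ) (σ * hL κ Φ t p D g f + ℓL κ Φ t p D g f) ∧
        (BFd κ Φ t p D c mk g f σ).B₀hi = Skelφ.pt (nL κ Φ t p D g f : ℤ) (σ * hL κ Φ t p D g f + ℓL κ Φ t p D g f) ∧
        (BFt κ Φ t p D c mk g f σ).B₀hi = Skelφ.pt (nL κ Φ t p D g f : ℤ) (σ * hL κ Φ t p D g f + ℓL κ Φ t p D g f)) ∧
      ((BFs κ Φ t p D c mk g f σ).R' = RA' κ Φ t p D mk ∧ (BFd κ Φ t p D c mk g f σ).R' = RA' κ Φ t p D mk ∧ (BFt κ Φ t p D c mk g f σ).R' = RA' κ Φ t p D mk) ∧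
      ((BFs κ Φ t p D c mk g f σ).pr = prBF κ Φ t p D c mk ∧ (BFd κ Φ t p D c mk g f σ).pr = prBF κ Φ t p D c mk ∧ (BFt κ Φ t p D c mk g f σ).pr = prBF κ Φ t p D c mk) :=
  ⟨⟨rfl, rfl, rfl⟩, ⟨rfl, rfl, rfl⟩, ⟨rfl, rfl, rfl⟩, ⟨rfl, rfl, rfl⟩⟩

/-- **`hRl₁`-shape**: `RlevA + 1 ≤ R′` for all three frames (`R′ = RA′ = RlevA + 1`). [folklore] -/
theorem BF_R'_ge (σ : ℤ) :
    RlevA κ Φ t p D mk + 1 ≤ (BFs κ Φ t p D c mk g f σ).R' ∧ RlevA κ Φ t p D mk + 1 ≤ (BFd κ Φ t p D c mk g f σ).R' ∧ RlevA κ Φ t p D mk + 1 ≤ (BFt κ Φ t p D c mk g f σ).R' := by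
  have h := (RA'_eq κ Φ t p D mk).2.1
  refine ⟨?_, ?_, ?_⟩ <;> (show RlevA κ Φ t p D mk + 1 ≤ RA' κ Φ t p D mk; omega)

/-- **`hB0`** for the face frames: the hop's landing box `[n_L, n_L] × [σh_L, σh_L + ℓ_L]` IS `B₀` (all three frames). [folklore] -/
theorem hB0_F (σ : ℤ) :
    Finset.Icc (Skelφ.pt (nL κ Φ t p D g f : ℤ) (σ * hL κ Φ t p D g f)) (Skelφ.pt (nL κ Φ t p D g f : ℤ) (σ * hL κ Φ t p D g f + ℓL κ Φ t p D g f)) ⊆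
        Finset.Icc (BFs κ Φ t p D c mk g f σ).B₀lo (BFs κ Φ t p D c mk g f σ).B₀hi ∧
      Finset.Icc (Skelφ.pt (nL κ Φ t p D g f : ℤ) (σ * hL κ Φ t p D g f)) (Skelφ.pt (nL κ Φ t p D g f : ℤ) (σ * hL κ Φ t p D g f + ℓL κ Φ t p D g f)) ⊆
        Finset.Icc (BFd κ Φ t p D c mk g f σ).B₀lo (BFd κ Φ t p D c mk g f σ).B₀hi ∧
      Finset.Icc (Skelφ.pt (nL κ Φ t p D g f : ℤ) (σ * hL κ Φ t p D g f)) (Skelφ.pt (nL κ Φ t p D g f : ℤ) (σ * hL κ Φ t p D g f + ℓL κ Φ t p D g f)) ⊆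
        Finset.Icc (BFt κ Φ t p D c mk g f σ).B₀lo (BFt κ Φ t p D c mk g f σ).B₀hi :=
  ⟨fun _ h => h, fun _ h => h, fun _ h => h⟩

/-- **The core-`1` reach budget of the face frames** `YbF := 2·(n_L + |h_L| + ℓ_L + RA′ + S_F + 11)` (`S_F = nBF + ℓBF + |hBF|`). [this work] -/
def YbF : ℕ := 2 * (nL κ Φ t p D g f + (hL κ Φ t p D g f).natAbs + ℓL κ Φ t p D g f + RA' κ Φ t p D mk + SF κ Φ t p D c mk + 11)

/-- **`|core1Lo|₁ ≤ YbF`** for the three face frames (`27 ≤ ℓBF`; hp-8's `hπ1` left side). [folklore] -/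
theorem core1LoF_l1 {σ : ℤ} (hσ : σ = 1 ∨ σ = -1) (hℓb : 27 ≤ ℓBF κ Φ t p D c mk) :
    ((BFs κ Φ t p D c mk g f σ).core1Lo 0).natAbs + ((BFs κ Φ t p D c mk g f σ).core1Lo 1).natAbs ≤ YbF κ Φ t p D c mk g f ∧
      ((BFd κ Φ t p D c mk g f σ).core1Lo 0).natAbs + ((BFd κ Φ t p D c mk g f σ).core1Lo 1).natAbs ≤ YbF κ Φ t p D c mk g f ∧
      ((BFt κ Φ t p D c mk g f σ).core1Lo 0).natAbs + ((BFt κ Φ t p D c mk g f σ).core1Lo 1).natAbs ≤ YbF κ Φ t p D c mk g f := by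
  have hσ' : |σ| = 1 := by rcases hσ with h | h <;> simp [h]
  have hs : |sgnz (hBF κ Φ t p D c mk)| = 1 := by rcases sgnz_cases (hBF κ Φ t p D c mk) with h | h <;> simp [h]
  have hY : (YbF κ Φ t p D c mk g f : ℤ) = 2 * ((nL κ Φ t p D g f : ℤ) + |hL κ Φ t p D g f| + ℓL κ Φ t p D g f + RA' κ Φ t p D mk +
      ((nBF κ Φ t p D c mk : ℤ) + ℓBF κ Φ t p D c mk + |hBF κ Φ t p D c mk|) + 11) := by unfold YbF SF; push_cast [Int.natCast_natAbs]; ring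
  have hℓb' : (27 : ℤ) ≤ ℓBF κ Φ t p D c mk := by exact_mod_cast hℓb
  have key : ∀ a b : ℤ, |a| + |b| ≤ (YbF κ Φ t p D c mk g f : ℤ) → a.natAbs + b.natAbs ≤ YbF κ Φ t p D c mk g f := fun a b h => by
    have : ((a.natAbs + b.natAbs : ℕ) : ℤ) ≤ (YbF κ Φ t p D c mk g f : ℤ) := by push_cast [Int.natCast_natAbs]; exact h
    exact_mod_cast this
  have hσh : |σ * hL κ Φ t p D g f| = |hL κ Φ t p D g f| := by rw [abs_mul, hσ', one_mul]
  have hσb : |σ * hBF κ Φ t p D c mk| = |hBF κ Φ t p D c mk| := by rw [abs_mul, hσ', one_mul]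
  have hσs : |σ * sgnz (hBF κ Φ t p D c mk) * nBF κ Φ t p D c mk| = nBF κ Φ t p D c mk := by rw [abs_mul, abs_mul, hσ', hs, one_mul, one_mul, Nat.abs_cast]
  have hRA : (0 : ℤ) ≤ (RA' κ Φ t p D mk : ℤ) := by positivity
  have hn : (0 : ℤ) ≤ (nL κ Φ t p D g f : ℤ) := by positivity
  have hnb : (0 : ℤ) ≤ (nBF κ Φ t p D c mk : ℤ) := by positivity
  have hℓL : (0 : ℤ) ≤ (ℓL κ Φ t p D g f : ℤ) := by positivity
  obtain ⟨hh1, hh2⟩ := abs_le.1 (le_of_eq hσh)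
  obtain ⟨hb1, hb2⟩ := abs_le.1 (le_of_eq hσb)
  obtain ⟨hs1, hs2⟩ := abs_le.1 (le_of_eq hσs)
  have hha := abs_nonneg (hL κ Φ t p D g f)
  have hba := abs_nonneg (hBF κ Φ t p D c mk)
  refine ⟨key _ _ ?_, key _ _ ?_, key _ _ ?_⟩
  · unfold BFs ChainPlanar.BridgePrm.core1Lo Skelφ.bridgeSame
    simp only [Pi.add_apply, Pi.sub_apply, Skelφ.pt_zero, Skelφ.pt_one, Pi.natCast_apply]
    rw [hY]
    have ha : |(nL κ Φ t p D g f : ℤ) - (RA' κ Φ t p D mk : ℕ) + nBF κ Φ t p D c mk| ≤ nL κ Φ t p D g f + RA' κ Φ t p D mk + nBF κ Φ t p D c mk :=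
      abs_le.2 ⟨by linarith, by linarith⟩
    have hb : |σ * hL κ Φ t p D g f - (RA' κ Φ t p D mk : ℕ) + σ * hBF κ Φ t p D c mk| ≤ |hL κ Φ t p D g f| + RA' κ Φ t p D mk + |hBF κ Φ t p D c mk| :=
      abs_le.2 ⟨by linarith, by linarith⟩
    linarith
  · unfold BFd ChainPlanar.BridgePrm.core1Lo Skelφ.bridgeTrSide
    simp only [Pi.add_apply, Pi.sub_apply, Skelφ.pt_zero, Skelφ.pt_one, Pi.natCast_apply]
    rw [hY]
    have ha : |(nL κ Φ t p D g f : ℤ) - (RA' κ Φ t p D mk : ℕ) + (|hBF κ Φ t p D c mk|)| ≤ nL κ Φ t p D g f + RA' κ Φ t p D mk + |hBF κ Φ t p D c mk| :=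
      abs_le.2 ⟨by linarith, by linarith⟩
    have hb : |σ * hL κ Φ t p D g f - (RA' κ Φ t p D mk : ℕ) + σ * sgnz (hBF κ Φ t p D c mk) * nBF κ Φ t p D c mk| ≤ |hL κ Φ t p D g f| + RA' κ Φ t p D mk + nBF κ Φ t p D c mk :=
      abs_le.2 ⟨by linarith, by linarith⟩
    linarith
  · unfold BFt ChainPlanar.BridgePrm.core1Lo Skelφ.bridgeTrTop
    simp only [Pi.add_apply, Pi.sub_apply, Skelφ.pt_zero, Skelφ.pt_one, Pi.natCast_apply]
    rw [hY]
    have ha : |(nL κ Φ t p D g f : ℤ) - (RA' κ Φ t p D mk : ℕ) + ((ℓBF κ Φ t p D c mk : ℤ) - |hBF κ Φ t p D c mk| - 11)| ≤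
        nL κ Φ t p D g f + RA' κ Φ t p D mk + ℓBF κ Φ t p D c mk + |hBF κ Φ t p D c mk| + 11 :=
      abs_le.2 ⟨by linarith, by linarith⟩
    have hb : |σ * hL κ Φ t p D g f - (RA' κ Φ t p D mk : ℕ) + -(nBF κ Φ t p D c mk : ℤ)| ≤ |hL κ Φ t p D g f| + RA' κ Φ t p D mk + nBF κ Φ t p D c mk :=
      abs_le.2 ⟨by linarith, by linarith⟩
    linarith

/-- **`YbF + 1 ≤ exA`** (hp-8's `hπ1` via `KS.ex_le_RπA`), given `|h_L| ≤ 10·n_L`, `S_F ≤ n_L`, `RA′ ≤ n_L`, `1 ≤ n_L` (all true at the tuple: `hκ`, `16·S_F ≤ M_L < n_L`,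
`nL_floorsT`). [folklore] -/
theorem YbF_le_exA (hκ : (hL κ Φ t p D g f).natAbs ≤ 10 * nL κ Φ t p D g f) (hS : SF κ Φ t p D c mk ≤ nL κ Φ t p D g f) (hR : RA' κ Φ t p D mk ≤ nL κ Φ t p D g f)
    (hn : 1 ≤ nL κ Φ t p D g f) : YbF κ Φ t p D c mk g f + 1 ≤ exA κ Φ t p D g f := by
  have h := (floors_exA κ Φ t p D g f).2.2.2.2.2.2.2.2
  unfold YbF; omega

end Frames

/-! ## §2 The α-clearance `M_u < B₀lo 0 − R′ − pr` at `g := gT mk gx` -/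

section AtT

variable (κ : Consts) {V : Type} [DecidableEq V] [Countable V] {G : SimpleGraph V} [G.LocallyFinite] (Φ : PlanarSkeletonNeg G) (t : V)
  (p : unitInterval) (D : DataN V) (c mk : ℕ) (gx : Neg.FSlot) (f : ℕ)

/-- **`hclr₁`** for the face frames at the WIDE pair (all three share the three fields; `KS.hclr₁_F` of part FaceFoot is the root-pair version): `M_u < B₀lo 0 − R′ − pr = n_L − RA′ − prBF` at `g := gT mk gx`, given the face floor
`16·S_F ≤ M_L` (`24M_u + 63 ≤ MBF < nBF ≤ S_F`, `5·eF ≤ M_L < n_L`). [folklore] -/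
theorem hclr₁_BF (hSF : 16 * SF κ Φ t p D c mk ≤ ML κ Φ t p D (gT mk gx κ Φ t p D)) (σ : ℤ) :
    ((Mu D : ℕ) : ℤ) < (BFs κ Φ t p D c mk (gT mk gx κ Φ t p D) f σ).B₀lo 0 - (BFs κ Φ t p D c mk (gT mk gx κ Φ t p D) f σ).R' - (BFs κ Φ t p D c mk (gT mk gx κ Φ t p D) f σ).pr ∧
      ((Mu D : ℕ) : ℤ) < (BFd κ Φ t p D c mk (gT mk gx κ Φ t p D) f σ).B₀lo 0 - (BFd κ Φ t p D c mk (gT mk gx κ Φ t p D) f σ).R' - (BFd κ Φ t p D c mk (gT mk gx κ Φ t p D) f σ).pr ∧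
      ((Mu D : ℕ) : ℤ) < (BFt κ Φ t p D c mk (gT mk gx κ Φ t p D) f σ).B₀lo 0 - (BFt κ Φ t p D c mk (gT mk gx κ Φ t p D) f σ).R' - (BFt κ Φ t p D c mk (gT mk gx κ Φ t p D) f σ).pr := by
  obtain ⟨⟨e1, e2, e3⟩, -, ⟨r1, r2, r3⟩, ⟨q1, q2, q3⟩⟩ := BF_shared κ Φ t p D c mk (gT mk gx κ Φ t p D) f σ
  rw [e1, e2, e3, r1, r2, r3, q1, q2, q3, Skelφ.pt_zero]
  have h1 := five_eF_le_ML κ Φ t p D c mk gx hSF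
  have h2 : ML κ Φ t p D (gT mk gx κ Φ t p D) + 1 ≤ nL κ Φ t p D (gT mk gx κ Φ t p D) f := by
    have := (ML_lt_nL κ Φ t p D (gT mk gx κ Φ t p D) f).1; omega
  have h3 := (MBF_floors κ Φ t p D c mk).2.1
  have h4 := (RF2F κ Φ t p D c mk).2.1
  have h5 : nBF κ Φ t p D c mk ≤ SF κ Φ t p D c mk := by unfold SF; omega
  have h7 : Mu D + RA' κ Φ t p D mk + prBF κ Φ t p D c mk < nL κ Φ t p D (gT mk gx κ Φ t p D) f := by unfold eF at h1; omega
  have h8 : ((Mu D + RA' κ Φ t p D mk + prBF κ Φ t p D c mk : ℕ) : ℤ) < (nL κ Φ t p D (gT mk gx κ Φ t p D) f : ℤ) := by exact_mod_cast h7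
  push_cast at h8
  refine ⟨by linarith, by linarith, by linarith⟩

end AtT

end KS

end NegB

end PlanarSkeletonNeg

end Summit.CriticalPhenomena.PercolationContinuityZ3.Theorems.Transplant

end
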